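import Summits.CriticalPhenomena.PercolationContinuityZ3.Theorems.Transplant.PlanarSkeletonFrmQuasiDefs
import Summits.CriticalPhenomena.PercolationContinuityZ3.Theorems.Transplant.SkelFrmQuasiBParamsCorrKGLenY
import Summits.CriticalPhenomena.PercolationContinuityZ3.Theorems.Transplant.SkelFrmBParamsCorrKGLenY
import Summits.CriticalPhenomena.PercolationContinuityZ3.Theorems.Transplant.SkelFrmQuasi1ParamsLBL
import Summits.CriticalPhenomena.PercolationContinuityZ3.Theorems.Transplant.SkelFrmQuasi1ParamsPO
import Summits.CriticalPhenomena.PercolationContinuityZ3.Theorems.Transplant.SkelFrmQuasiBParamsCorrKG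
import Summits.CriticalPhenomena.PercolationContinuityZ3.Theorems.Transplant.SkelFrmQuasiBParamsCorrKG0
import Summits.CriticalPhenomena.PercolationContinuityZ3.Theorems.Transplant.SkelFrmQuasiBParamsCorrKGLen
import Summits.CriticalPhenomena.PercolationContinuityZ3.Theorems.Transplant.SkelFrmQuasiBParamsCorrKGY
import Summits.CriticalPhenomena.PercolationContinuityZ3.Theorems.Transplant.SkelFrmQuasiBParamsLF
import HarnessLib
import Summits.CriticalPhenomena.PercolationContinuityZ3.Theorems.Transplant.SkelFrmBParamsCorrKGLen3
/-!
# GEN-Q PORT (WAVE-Q table v0.8 section 2, row G062, U-level L10; captain R-6/R-7 2026-08-27: carrier token swap `PlanarSkeletonFrmFrom ↦ PlanarSkeletonFrmQuasi`)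
# of the tree module «Transplant/SkelFrmFromBParamsCorrKGLen3» (sha256 d86c59901294166e…) onto the quasi-step carrier `PlanarSkeletonFrmQuasi` (p507026): «SkelFrmQuasiBParamsCorrKGLen3»

ORIGINAL TITLE: N2 (frames-only node `SamePDropOfSkeletonFrmFrom₁`, OPEN) — (ζ″) ledger under J23/(R-44): THE CORRIDOR BUDGETS WITH HEADROOM FOR EVERY WINDOW OF RECORD UP TO

builds on p205010 (kernel theorem, internal audit signed; external expert review pending) — nothing in this file uses p205010; NOTHING is claimed about any open node
((N3-b), the end state).  Lane `prim-bschramm`, seat `prim-bschramm-stmt` (gen 33; GEN-Q column pen; tool = captain gen-1 g4's port_genq.py R-14 --cone + p3-g30's T1 patch).  Helper file (`--supports stmt-CriticalPhenomena-4575 --as helper`).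
PORT RULES (U-wave r1–r4 re-used, GEN-Q hunk classes of p3-g29 #6136): declaration order, names and proof texts are those of «SkelFrmFromBParamsCorrKGLen3», byte-identical except
(i) the carrier token `PlanarSkeletonFrmFrom ↦ PlanarSkeletonFrmQuasi` in binders, `namespace`/`end` lines and qualified names (module names `SkelFrmFrom… ↦ SkelFrmQuasi…`
in imports of already-ported rows); (ii) `Φ.step ↦ Φ.qstep` with the called Steps lemma replaced by its `…Q`/`_q` twin and the cost `Φ.M` threaded (none in this file unless
listed below); (iii) `Φ.cyl_connected ↦ Φ.cyl_reach` readers (none unless listed); (iv) graph-ball radii / window floors ×`Φ.M` (none unless listed).  Carrier-free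
residents stay imported/exported from the original «SkelFrmBParamsCorrKGLen3» exactly as in the FrmFrom port.  Docstrings and citations are the original's.

-/

open scoped Classical

noncomputable section

namespace Summit.CriticalPhenomena.PercolationContinuityZ3.Theorems.Transplant

namespace Skelφ

open Literature.Probability.Percolation Literature.Probability.LatticeModels SimpleGraph

section Budget3

variable {n ℓ : ℕ} {hs v : ℤ} {R' ρ q W : ℕ}

end Budget3

end Skelφ

/-! ## At the values of record (`ρ := 0`): the successor residual floors and the two budgets -/

namespace PlanarSkeletonFrmQuasi

namespace NegB

open Literature.Probability.Percolation Literature.Probability.LatticeModels SimpleGraph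
open SkelConc (Consts)
open Skelφ (shearUnit kgSL kgSLY kgM₁ kgM₂ kgM₁Y kgM₂Y KGRows KGYRows)
open Neg

section Values3

variable (κ : Consts) {V : Type} [DecidableEq V] [Countable V] {G : SimpleGraph V} [G.LocallyFinite] (Φ : PlanarSkeletonFrmQuasi G) (t : V) (p : unitInterval)
  (D : Skelφ.StepI.DataNS V) (g f mk qx Wx : ℕ)

/-- **The residual floors with headroom, first axis**: `qx ≤ 100·n_L`, `Wx ≤ 20·sL`. [this work] -/
structure KGRes3 : Prop where
  /-- `qx ≤ 100·n_L` -/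
  hqx : qx ≤ 100 * nL κ Φ t p D g f
  /-- `Wx ≤ 20·sL` -/
  hWx : (Wx : ℤ) ≤ 20 * kgSL (nL κ Φ t p D g f) (ℓL κ Φ t p D g f) (hL κ Φ t p D g f)

/-- **The residual floors with headroom, second axis**: `qx ≤ 40·sL` (rows), `Wx ≤ 100·n_L` (x′ units). [this work] -/
structure KGResY3 : Prop where
  /-- `qx ≤ 40·sL` -/
  hqx : (qx : ℤ) ≤ 40 * kgSLY (nL κ Φ t p D g f) (ℓL κ Φ t p D g f) (hL κ Φ t p D g f)
  /-- `Wx ≤ 100·n_L` -/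
  hWx : Wx ≤ 100 * nL κ Φ t p D g f

-- GEN-Q (R-2, captain 2026-08-27): `PlanarSkeletonFrmFrom.NegB.KGRes3.toWx` is not in the used cone of the node top — not ported.

/-- **THE CORRIDOR FITS THE BUDGET at the wider along window** (`ρ := 0`, `KGRes3`): `N + 1 + (m₁+1) + (m₂+1) ≤ LfQ κ.K₀`. [this work] -/
theorem kgSchedN_le_LfQ3 (κ : Consts) {V : Type} [DecidableEq V] [Countable V] {G : SimpleGraph V} [G.LocallyFinite] (Φ : PlanarSkeletonFrmQuasi G) (t : V) (p : unitInterval) (D : Skelφ.StepI.DataNS V) (g : ℕ) (f : ℕ) (mk : ℕ) (qx : ℕ) (Wx : ℕ) (hN : EqNumL κ Φ t p D g f) (hg : gFloorKG κ Φ t p D mk ≤ g) (hx : KGRes3 κ Φ t p D g f qx Wx) :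
    kgNv0 κ Φ t p D g f mk qx Wx + 1 +
        (kgM₁ (nL κ Φ t p D g f) (ℓL κ Φ t p D g f) (hL κ Φ t p D g f) (kgR κ Φ t p D mk) 0 (kgW κ Φ t p D g f Wx)
          (kgNv0 κ Φ t p D g f mk qx Wx) + 1) +
        (kgM₂ (nL κ Φ t p D g f) (ℓL κ Φ t p D g f) (hL κ Φ t p D g f) (vL κ Φ t p D g f) (kgR κ Φ t p D mk) 0 (kgq κ Φ t p D g f qx)
          (kgW κ Φ t p D g f Wx) (kgNv0 κ Φ t p D g f mk qx Wx) + 1) ≤ LfQ κ.K₀ := by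
  have H := kgRows0_of κ Φ t p D g f mk qx Wx hN hg
  obtain ⟨hS, hSn, -, hR8, hW2⟩ := kg_floors κ Φ t p D g f mk Wx hN hg hx.hWx
  have hNle := kgNv0_le κ Φ t p D g f mk qx Wx hN hg
  have hK := (Skelφ.NegPrm.forty_le_Kcell κ.K₀).1
  have hK' : (40 : ℤ) ≤ (Neg.K κ : ℤ) := by unfold Neg.K; exact_mod_cast hK
  have hNz : ((kgNv0 κ Φ t p D g f mk qx Wx : ℕ) : ℤ) ≤ 20 * (Neg.K κ : ℤ) + 4 := by exact_mod_cast hNle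
  have hq6 : ((kgq κ Φ t p D g f qx : ℕ) : ℤ) ≤ 102 * (nL κ Φ t p D g f : ℤ) := by
    have hqx : qx ≤ 100 * nL κ Φ t p D g f := hx.hqx
    unfold kgq; push_cast
    have : ((qx : ℕ) : ℤ) ≤ 100 * (nL κ Φ t p D g f : ℤ) := by exact_mod_cast hqx
    linarith
  have hb := H.kgSchedN_budget3 hS hSn hR8 hW2 hq6 hK' (kgNv0 κ Φ t p D g f mk qx Wx) hNz
  have hZ : ((kgNv0 κ Φ t p D g f mk qx Wx + 1 +
        (kgM₁ (nL κ Φ t p D g f) (ℓL κ Φ t p D g f) (hL κ Φ t p D g f) (kgR κ Φ t p D mk) 0 (kgW κ Φ t p D g f Wx)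
          (kgNv0 κ Φ t p D g f mk qx Wx) + 1) +
        (kgM₂ (nL κ Φ t p D g f) (ℓL κ Φ t p D g f) (hL κ Φ t p D g f) (vL κ Φ t p D g f) (kgR κ Φ t p D mk) 0 (kgq κ Φ t p D g f qx)
          (kgW κ Φ t p D g f Wx) (kgNv0 κ Φ t p D g f mk qx Wx) + 1) : ℕ) : ℤ) ≤ ((LfQ κ.K₀ : ℕ) : ℤ) := by
    rw [LfQ_eq]; push_cast; linarith
  exact_mod_cast hZ

/-- **THE N-CORRIDOR FITS THE BUDGET at the wider across window** (`ρ := 0`, `KGResY3`): `N + 1 + (m₁+1) + (m₂+1) ≤ LfQ κ.K₀`. [this work] -/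
theorem kgSchedNY_le_LfQ3 (κ : Consts) {V : Type} [DecidableEq V] [Countable V] {G : SimpleGraph V} [G.LocallyFinite] (Φ : PlanarSkeletonFrmQuasi G) (t : V) (p : unitInterval) (D : Skelφ.StepI.DataNS V) (g : ℕ) (f : ℕ) (mk : ℕ) (qx : ℕ) (Wx : ℕ) (hN : EqNumL κ Φ t p D g f) (hg : gFloorKG κ Φ t p D mk ≤ g) (hx : KGResY3 κ Φ t p D g f qx Wx) :
    kgNYv0 κ Φ t p D g f mk qx Wx + 1 +
        (kgM₁Y (nL κ Φ t p D g f) (vL κ Φ t p D g f) (kgR κ Φ t p D mk) 0 (kgWY κ Φ t p D g f Wx) (kgNYv0 κ Φ t p D g f mk qx Wx) + 1) +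
        (kgM₂Y (nL κ Φ t p D g f) (ℓL κ Φ t p D g f) (hL κ Φ t p D g f) (vL κ Φ t p D g f) (kgR κ Φ t p D mk) 0 (kgqY κ Φ t p D g f qx)
          (kgWY κ Φ t p D g f Wx) (kgNYv0 κ Φ t p D g f mk qx Wx) + 1) ≤ LfQ κ.K₀ := by
  have H := kgYRows0_of κ Φ t p D g f mk qx Wx hN hg
  obtain ⟨hSn, hS, hR8, hbig, hρP⟩ := kgY_floors κ Φ t p D g f mk hN hg
  have hNle := kgNYv0_le κ Φ t p D g f mk qx Wx hN hg
  have hK := (Skelφ.NegPrm.forty_le_Kcell κ.K₀).1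
  have hK' : (40 : ℤ) ≤ (Neg.K κ : ℤ) := by unfold Neg.K; exact_mod_cast hK
  have hNz : ((kgNYv0 κ Φ t p D g f mk qx Wx : ℕ) : ℤ) ≤ 21 * (Neg.K κ : ℤ) + 2 := by exact_mod_cast hNle
  have hW : ((kgWY κ Φ t p D g f Wx : ℕ) : ℤ) ≤ 102 * (nL κ Φ t p D g f : ℤ) := by
    have hWx : Wx ≤ 100 * nL κ Φ t p D g f := hx.hWx
    unfold kgWY; push_cast
    have : ((Wx : ℕ) : ℤ) ≤ 100 * (nL κ Φ t p D g f : ℤ) := by exact_mod_cast hWx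
    linarith
  have hq : ((kgqY κ Φ t p D g f qx : ℕ) : ℤ) ≤ 41 * kgSLY (nL κ Φ t p D g f) (ℓL κ Φ t p D g f) (hL κ Φ t p D g f) + 2 := by
    have hqx := hx.hqx
    have hPd := Skelφ.natDiv_le_kgSLY (one_le_of_eqNumL κ Φ t p D g f hN).1 (ℓL κ Φ t p D g f) (hL κ Φ t p D g f)
    unfold kgqY
    push_cast [Nat.cast_add] at hPd ⊢
    linarith
  have hb := H.kgSchedNY_budget3 hSn hS hR8 hW hq hρP hbig hK' (kgNYv0 κ Φ t p D g f mk qx Wx) hNz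
  have hZ : ((kgNYv0 κ Φ t p D g f mk qx Wx + 1 +
        (kgM₁Y (nL κ Φ t p D g f) (vL κ Φ t p D g f) (kgR κ Φ t p D mk) 0 (kgWY κ Φ t p D g f Wx) (kgNYv0 κ Φ t p D g f mk qx Wx) + 1) +
        (kgM₂Y (nL κ Φ t p D g f) (ℓL κ Φ t p D g f) (hL κ Φ t p D g f) (vL κ Φ t p D g f) (kgR κ Φ t p D mk) 0 (kgqY κ Φ t p D g f qx)
          (kgWY κ Φ t p D g f Wx) (kgNYv0 κ Φ t p D g f mk qx Wx) + 1) : ℕ) : ℤ) ≤ ((LfQ κ.K₀ : ℕ) : ℤ) := by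
    rw [LfQ_eq]; push_cast; linarith
  exact_mod_cast hZ

end Values3

end NegB

end PlanarSkeletonFrmQuasi

end Summit.CriticalPhenomena.PercolationContinuityZ3.Theorems.Transplant

end
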